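import Mathlib
import HarnessLib

/-!
# The integral of a step function `x ↦ F ⌊x⌋₊` is a discrete sum (KMT discretisation)

Support lemma for the crux `DigitPolyUniformity` (stmt-QuantumAdvantage-1392), line `Sketch`
(`Cruxes/DigitPolyUniformity/Lines/SketchLAR.lean`, cycle 7: the Klurman–Mangerel–Teräväinen class).
The Klurman–Mangerel–Teräväinen named fact is an integral `∫_X^{2X} G(x) dx` whose integrand depends
on `x` only through `⌊x⌋` (sums over the integers in `(x, x+H]`); the line turns it into the sum
`Σ_{m = X}^{2X-1} G(m)` with the present discretisation: for `F : ℕ → ℝ` and naturals `X ≤ Y`,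
`∫_X^Y F ⌊x⌋₊ dx = Σ_{m ∈ [X, Y)} F m`, because on each open unit interval `(m, m+1)` one has
`⌊x⌋₊ = m`, so the integrand is constant there, and the integer end-points are Lebesgue-null.

Main result: `stub_kmt_discretise`; the unit-interval pieces are `Discretise.integral_floor_unit`
and `Discretise.intervalIntegrable_floor_unit`.
-/

noncomputable section

namespace Summit.QuantumAdvantage.DigitPolyUniformity.SketchLAR.KMT

open Finset MeasureTheory intervalIntegral

namespace Discretise

/-- On the open unit interval `(m, m+1)` (`m` a natural number) the step function `x ↦ F ⌊x⌋₊`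
takes the value `F m`. [folklore] -/
theorem apply_floor_eq_of_mem_Ioo (F : ℕ → ℝ) (m : ℕ) :
    ∀ x ∈ Set.Ioo (m : ℝ) ((m + 1 : ℕ) : ℝ), F ⌊x⌋₊ = F m := by
  intro x hx
  rw [Nat.floor_eq_on_Ico m x (Set.Ioo_subset_Ico_self (by simpa using hx))]

/-- The step function `x ↦ F ⌊x⌋₊` is interval integrable on each unit interval `[m, m+1]`
(it agrees with the constant `F m` off the end-points). [folklore] -/
theorem intervalIntegrable_floor_unit (F : ℕ → ℝ) (m : ℕ) :
    IntervalIntegrable (fun x : ℝ => F ⌊x⌋₊) volume (m : ℝ) ((m + 1 : ℕ) : ℝ) := by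
  have hle : (m : ℝ) ≤ ((m + 1 : ℕ) : ℝ) := by push_cast; linarith
  rw [intervalIntegrable_iff_integrableOn_Ioo_of_le hle]
  exact (integrableOn_const (C := F m) (hs := measure_Ioo_lt_top.ne)).congr_fun
    (fun x hx => (apply_floor_eq_of_mem_Ioo F m x hx).symm) measurableSet_Ioo

/-- The integral of the step function `x ↦ F ⌊x⌋₊` over the unit interval `[m, m+1]` is `F m`.
[folklore] -/
theorem integral_floor_unit (F : ℕ → ℝ) (m : ℕ) :
    ∫ x in (m : ℝ)..((m + 1 : ℕ) : ℝ), F ⌊x⌋₊ = F m := by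
  have hle : (m : ℝ) ≤ ((m + 1 : ℕ) : ℝ) := by push_cast; linarith
  rw [intervalIntegral.integral_of_le hle, integral_Ioc_eq_integral_Ioo,
    setIntegral_congr_fun measurableSet_Ioo (apply_floor_eq_of_mem_Ioo F m), setIntegral_const,
    Real.volume_real_Ioo_of_le hle,
    show ((m + 1 : ℕ) : ℝ) - (m : ℝ) = 1 by push_cast; ring, one_smul]

end Discretise

/-- **Discretisation of the integral of a step function (c6/cycle 7, KMT class).** For `F : ℕ → ℝ`
and naturals `X ≤ Y`: `∫_X^Y F ⌊x⌋₊ dx = Σ_{m ∈ [X, Y)} F m` — on each unit interval `(m, m+1)` the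
integrand is the constant `F m`, and the integer end-points are Lebesgue-null. [folklore] -/
theorem stub_kmt_discretise (F : ℕ → ℝ) (X Y : ℕ) (hXY : X ≤ Y) :
    ∫ x in (X : ℝ)..(Y : ℝ), F ⌊x⌋₊ = ∑ m ∈ Ico X Y, F m := by
  rw [← intervalIntegral.sum_integral_adjacent_intervals_Ico (a := fun k : ℕ => (k : ℝ))
    (μ := volume) hXY (fun k _ => Discretise.intervalIntegrable_floor_unit F k)]
  exact Finset.sum_congr rfl fun k _ => Discretise.integral_floor_unit F k

end Summit.QuantumAdvantage.DigitPolyUniformity.SketchLAR.KMT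

end
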